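import Literature.Probability.LatticeModels.DartPhase
import Literature.Probability.LatticeModels.DirichletGreenFunction
import Literature.Probability.RandomPlanarGeometry.PlanarDomains
import Summits.CriticalPhenomena.CardyFormulaZ2.Theorems.CardySusyWardParafermionPrecompactKenyonDefs
import Summits.CriticalPhenomena.CardyFormulaZ2.Theorems.CardySusyWardParafermionPrecompactSignedHopf
import Literature.Probability.LatticeModels.LatticeLoopWinding
import Literature.Probability.LatticeModels.MedialCycleHopf

/-!
# The signed Umlaufsatz for simple closed lattice walks (helper for stub `stub_vertexRelation`)

Line `kenyon-stream-second-relation` of the crux `ParafermionPrecompact` (route `CardySusyWard`,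
item stmt-CriticalPhenomena-11293). For a simple closed walk `c : ClosedWalk n` on `ℤ²`
(`LatticeLoopWinding.lean`: unit axis-parallel steps, every vertex passed once per period,
`n ≥ 3`) the tree knows the UNSIGNED Umlaufsatz `∑ cross = ±4` (`ClosedWalk.sum_cross_eq`, from
the combinatorial `RectLoop.IsLoop.cycTurn_eq`) and that the winding number `R = W (rf v₀ v₁)`
of the face to the right of a step is the same for all steps (`ClosedWalk.W_rf_eq`). This file
ties the two together — the SIGNED Umlaufsatz needed to orient the loops excised by the
one-edge involution at spin `σ = 1/3` (where, unlike Smirnov's `σ = 1/2`, the sign of the `2π`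
turn of a loop matters):

* `closedWalk_sum_cross_and_W_rf`: **`∑ cross = 4` and `R = 0`, or `∑ cross = -4` and `R = -1`**
  (counter-clockwise walks have the unbounded winding number `0` on their right, clockwise ones
  have `-1`).

Proof. `hopf_closed_signed` (`…SignedHopf.lean`) is the tree's discrete Hopf Umlaufsatz
`hopf_closed` with its sign made explicit: based at a lowest vertex `z₀`, the total turning is `+2π`
iff `arg (z₁ - z₀) ≤ arg (z_{n-1} - z₀)`. For a lattice walk based at its lowest-then-leftmost vertex the two neighbours are the
east and the north neighbour; leaving east gives `+2π` and the right face of that step lies below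
the walk (`W = 0`, `W_eq_zero_of_lt_snd`); leaving north gives `-2π` and the right face is the
north-east face of `z₀`, reached from the (unvisited) faces below and to the west across the
north step, traversed once upwards (`W = -1`). The exterior angles of unit lattice steps are
`(π/2)·cross` (`toReal_argDiff_dir`), and the subtended-angle hypothesis of `hopf_closed` on
`ℤ²` is the tree's `dot_pos` (`MedialCycleHopf.lean`). Also recorded: across every step the
left face has winding number `R + 1` (`closedWalk_W_lf`).

References: H. Hopf, *Über die Drehung der Tangenten und Sehnen ebener Kurven*, Compositio
Math. 2 (1935), Satz I [Hopf1935]; S. Smirnov, Ann. of Math. 172 (2010), §4 (Fig. 5: the rounded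
medial loops) [Smirnov2010].
-/

noncomputable section

namespace Summit.CriticalPhenomena.CardyFormulaZ2.Cruxes.ParafermionPrecompact.KenyonStreamSecondRelation

open Complex Finset Real
open _root_.Literature.Topology.PlaneTopology _root_.Literature.Topology.PlaneTopology.RectLoop
open _root_.Literature.Probability.RandomPlanarGeometry.SAW.Hopf
open _root_.Literature.Probability.LatticeModels

/-! ### Lattice steps as complex numbers -/

/-- The exterior angle between two unit lattice steps that are not opposite is `(π/2)·cross`.
[folklore] -/
theorem toReal_argDiff_dir {i i' : Fin 4} (h : i' ≠ i + 2) :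
    ((Complex.arg (((dir i').1 : ℂ) + ((dir i').2 : ℂ) * I) : Angle) -
      (Complex.arg (((dir i).1 : ℂ) + ((dir i).2 : ℂ) * I) : Angle)).toReal =
      π / 2 * cross (dir i) (dir i') := by
  have hcases : i' = i ∨ i' = i + 1 ∨ i' = i + 3 := by revert i i' h; decide
  rw [embZ2_dir, embZ2_dir]
  have hIk : I ^ (i : ℕ) ≠ 0 := pow_ne_zero _ I_ne_zero
  rcases hcases with rfl | rfl | rfl
  · rw [sub_self, Angle.toReal_zero]
    have : cross (dir i') (dir i') = 0 := by fin_cases i' <;> rfl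
    rw [this]; simp
  · rw [I_pow_fin_succ, show I ^ (i : ℕ) * I = I * I ^ (i : ℕ) by ring,
      toReal_argDiff_mul_left I_ne_zero hIk, Complex.arg_I]
    have : cross (dir i) (dir (i + 1)) = 1 := by fin_cases i <;> rfl
    rw [this]; simp
  · rw [I_pow_fin_add_three, show -(I ^ (i : ℕ) * I) = (-I) * I ^ (i : ℕ) by ring,
      toReal_argDiff_mul_left (neg_ne_zero.2 I_ne_zero) hIk, Complex.arg_neg_I]
    have : cross (dir i) (dir (i + 3)) = -1 := by fin_cases i <;> rfl
    rw [this]; simp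

/-- Sums over one period of a periodic sequence are shift invariant. [folklore] -/
theorem sum_range_shift_of_periodic {G : Type*} [AddCommGroup G] {g : ℕ → G} {n : ℕ}
    (h : ∀ j, g (j + n) = g j) (a : ℕ) : ∑ j ∈ range n, g (a + j) = ∑ j ∈ range n, g j := by
  induction a with
  | zero => simp
  | succ a ih =>
    rw [← ih]
    have := sum_range_succ_of_periodic (g := fun j => g (a + j)) (n := n)
      (by simp only [add_zero]; exact h a)
    rw [← this]
    exact sum_congr rfl fun j _ => by rw [show a + 1 + j = a + (j + 1) by omega]

/-! ### The signed Umlaufsatz for simple closed lattice walks -/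

section Walk

variable {n : ℕ} (c : ClosedWalk n)

/-- The step vector of a closed walk as a direction index. [folklore] -/
theorem exists_step_eq_dir (j : ℕ) : ∃ i : Fin 4, c.v (j + 1) - c.v j = dir i := by
  obtain ⟨i, hi⟩ := c.adj j
  exact ⟨i, by rw [hi, add_sub_cancel_left]⟩

/-- On a simple walk of period at least `3`, consecutive steps are not opposite. [folklore] -/
theorem step_ne_neg_step (hs : c.Simple) (hn : 3 ≤ n) (j : ℕ) {i i' : Fin 4}
    (hi : c.v (j + 1) - c.v j = dir i) (hi' : c.v (j + 2) - c.v (j + 1) = dir i') : i' ≠ i + 2 := by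
  intro h
  apply c.v_ne_v_add_two hs hn j
  have : c.v (j + 2) = c.v j + dir i + dir i' := by
    rw [← hi, ← hi']; abel
  rw [this, h, ← neg_dir]; abel

/-- **Left minus right is one.** Across every step of a simple closed walk the face on the left
(the right face of the reversed step) has winding number one more than the face on the right.
[folklore] -/
theorem closedWalk_W_lf (hs : c.Simple) (hn : 3 ≤ n) (j : ℕ) :
    c.W (ClosedWalk.rf (c.v (j + 1)) (c.v j)) = c.W (ClosedWalk.rf (c.v j) (c.v (j + 1))) + 1 := by
  have hn0 : 0 < n := by omega
  have hfw : c.cnt (c.v j) (c.v (j + 1)) = 1 := by rw [c.cnt_out hs hn0]; simp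
  have hbw : c.cnt (c.v (j + 1)) (c.v j) = 0 := by
    rw [c.cnt_out hs hn0, indZ_of_neg]
    exact fun h => c.v_ne_v_add_two hs hn j h.symm
  rcases hP : c.v j with ⟨a, b⟩
  rw [hP] at hfw hbw
  rcases c.step j with h | h | h | h <;> rw [hP] at h <;> obtain ⟨h1, h2⟩ := h <;> simp only at h1 h2
  · -- east: left face `(a, b)`, right face `(a, b - 1)`
    have hQ : c.v (j + 1) = (a + 1, b) := Prod.ext h1 h2
    rw [hQ] at hfw hbw ⊢
    have hr : ClosedWalk.rf (a, b) (a + 1, b) = (a, b - 1) := by simp [ClosedWalk.rf]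
    have hl : ClosedWalk.rf (a + 1, b) (a, b) = (a, b) := by simp [ClosedWalk.rf, Prod.ext_iff]
    have e := c.W_succ_snd a (b - 1)
    rw [sub_add_cancel, c.cH_eq_cnt, hfw, hbw] at e
    rw [hr, hl, e]; ring
  · -- north: left `(a - 1, b)`, right `(a, b)`
    have hQ : c.v (j + 1) = (a, b + 1) := Prod.ext h1 h2
    rw [hQ] at hfw hbw ⊢
    have hr : ClosedWalk.rf (a, b) (a, b + 1) = (a, b) := by simp [ClosedWalk.rf, Prod.ext_iff]
    have hl : ClosedWalk.rf (a, b + 1) (a, b) = (a - 1, b) := by simp [ClosedWalk.rf, Prod.ext_iff]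
    have e := c.W_succ_fst (a - 1) b
    rw [sub_add_cancel, c.cV_eq_cnt, hfw, hbw] at e
    rw [hr, hl, e]; ring
  · -- west: left `(a - 1, b - 1)`, right `(a - 1, b)`
    have hQ : c.v (j + 1) = (a - 1, b) := Prod.ext h1 h2
    rw [hQ] at hfw hbw ⊢
    have hr : ClosedWalk.rf (a, b) (a - 1, b) = (a - 1, b) := by
      simp [ClosedWalk.rf, Prod.ext_iff, sub_eq_add_neg]
    have hl : ClosedWalk.rf (a - 1, b) (a, b) = (a - 1, b - 1) := by
      simp [ClosedWalk.rf]
    have e := c.W_succ_snd (a - 1) (b - 1)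
    rw [sub_add_cancel, c.cH_eq_cnt, sub_add_cancel, hfw, hbw] at e
    rw [hr, hl, e]; ring
  · -- south: left `(a, b - 1)`, right `(a - 1, b - 1)`
    have hQ : c.v (j + 1) = (a, b - 1) := Prod.ext h1 h2
    rw [hQ] at hfw hbw ⊢
    have hr : ClosedWalk.rf (a, b) (a, b - 1) = (a - 1, b - 1) := by
      simp [ClosedWalk.rf, Prod.ext_iff, sub_eq_add_neg]
    have hl : ClosedWalk.rf (a, b - 1) (a, b) = (a, b - 1) := by
      simp [ClosedWalk.rf, Prod.ext_iff]
    have e := c.W_succ_fst (a - 1) (b - 1)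
    rw [sub_add_cancel, c.cV_eq_cnt, sub_add_cancel, hfw, hbw] at e
    rw [hr, hl, e]; ring

/-- **The signed Umlaufsatz for simple closed lattice walks** (registered helper of
`stub_vertexRelation`). For a simple closed walk on `ℤ²` of period `n ≥ 3`, either the quarter
turns sum to `4` and the right winding number is `0` (counter-clockwise), or they sum to `-4` and
the right winding number is `-1` (clockwise). [cite: Hopf1935, Satz I] -/
theorem closedWalk_sum_cross_and_W_rf :
    ∀ (n : ℕ) (c : ClosedWalk n), c.Simple → 3 ≤ n →
      (∑ j ∈ Finset.range n, RectLoop.cross (c.v (j + 1) - c.v j) (c.v (j + 2) - c.v (j + 1)) = 4 ∧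
          c.W (ClosedWalk.rf (c.v 0) (c.v 1)) = 0) ∨
        (∑ j ∈ Finset.range n, RectLoop.cross (c.v (j + 1) - c.v j) (c.v (j + 2) - c.v (j + 1)) = -4 ∧
          c.W (ClosedWalk.rf (c.v 0) (c.v 1)) = -1) := by
  intro n c hs hn
  have hn0 : 0 < n := by omega
  -- the lowest-then-leftmost vertex
  obtain ⟨j₀, hj₀, hmin⟩ := exists_min_image (range n) (fun j => toLex ((c.v j).2, (c.v j).1))
    ⟨0, mem_range.2 hn0⟩
  have hmin' : ∀ j, (c.v j₀).2 < (c.v j).2 ∨ ((c.v j₀).2 = (c.v j).2 ∧ (c.v j₀).1 ≤ (c.v j).1) := by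
    intro j
    have h := hmin (j % n) (mem_range.2 (Nat.mod_lt _ hn0))
    rw [c.v_mod] at h
    rcases (Prod.Lex.le_iff (x := toLex ((c.v j₀).2, (c.v j₀).1)) (y := toLex ((c.v j).2, (c.v j).1))).1 h
      with h | ⟨h1, h2⟩
    · exact Or.inl h
    · exact Or.inr ⟨h1, h2⟩
  have hlow : ∀ j, (c.v j₀).2 ≤ (c.v j).2 := fun j => by
    rcases hmin' j with h | h
    · exact h.le
    · exact h.1.le
  set X₀ := (c.v j₀).1 with hX₀
  set Y₀ := (c.v j₀).2 with hY₀
  have hv₀ : c.v j₀ = (X₀, Y₀) := rfl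
  -- the previous vertex
  set jp := j₀ + (n - 1) with hjp
  have hjp1 : jp + 1 = j₀ + n := by omega
  have hvjp1 : c.v (jp + 1) = c.v j₀ := by rw [hjp1, c.periodic]
  -- the two neighbours of the base vertex are its east and north neighbours
  have hnext : c.v (j₀ + 1) = (X₀ + 1, Y₀) ∨ c.v (j₀ + 1) = (X₀, Y₀ + 1) := by
    rcases c.step j₀ with h | h | h | h
    · exact Or.inl (Prod.ext h.1 h.2)
    · exact Or.inr (Prod.ext h.1 h.2)
    · exfalso; rcases hmin' (j₀ + 1) with h' | h' <;> omega
    · exfalso; have := hlow (j₀ + 1); omega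
  have hprev : c.v jp = (X₀ + 1, Y₀) ∨ c.v jp = (X₀, Y₀ + 1) := by
    rcases c.step jp with h | h | h | h <;> rw [hvjp1] at h
    · exfalso; rcases hmin' jp with h' | h' <;> omega
    · exfalso; have := hlow jp; omega
    · exact Or.inl (Prod.ext (by omega) (by omega))
    · exact Or.inr (Prod.ext (by omega) (by omega))
  have hne_pn : c.v (j₀ + 1) ≠ c.v jp := by
    intro h
    have h1 : (1 : ℕ) % n = (n - 1) % n := Nat.ModEq.add_left_cancel' j₀ (hs.inj _ _ h)
    rw [Nat.mod_eq_of_lt (show 1 < n by omega), Nat.mod_eq_of_lt (show n - 1 < n by omega)] at h1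
    omega
  -- Hopf at the base vertex
  set z : ℕ → ℂ := fun j => (((c.v (j₀ + j)).1 : ℂ) + ((c.v (j₀ + j)).2 : ℂ) * I) with hz
  have hzn : z n = z 0 := by simp only [hz, add_zero, c.periodic]
  have hzn1 : z (n + 1) = z 1 := by
    simp only [hz]; rw [show j₀ + (n + 1) = (j₀ + 1) + n by omega, c.periodic]
  have hinj : ∀ i j : ℕ, i < n → j < n → z i = z j → i = j := by
    intro i j hi hj h
    have h1 : i % n = j % n := Nat.ModEq.add_left_cancel' j₀ (hs.inj _ _ (embZ2_injective h))
    rwa [Nat.mod_eq_of_lt hi, Nat.mod_eq_of_lt hj] at h1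
  have hsub : ∀ k j : ℕ, k < n → j < n → z j ≠ z k → z j ≠ z (k + 1) →
      0 < ((z (k + 1) - z j) * (starRingEnd ℂ) (z k - z j)).re := by
    intro k j hk hj h1 h2
    obtain ⟨d, hd⟩ := exists_step_eq_dir c (j₀ + k)
    have hd' : c.v (j₀ + (k + 1)) = c.v (j₀ + k) + dir d := by
      rw [show j₀ + (k + 1) = j₀ + k + 1 by omega, ← hd]; abel
    simp only [hz] at h1 h2 ⊢
    rw [hd', embZ2_sub, embZ2_sub, embZ2_mul_conj_re,
      show c.v (j₀ + k) + dir d - c.v (j₀ + j) = (c.v (j₀ + k) - c.v (j₀ + j)) + dir d by abel]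
    have := dot_pos (A := c.v (j₀ + k) - c.v (j₀ + j)) d
      (fun h0 => h1 (by rw [(sub_eq_zero.1 h0)]))
      (fun h0 => h2 (by
        rw [hd', ← sub_eq_zero, embZ2_sub]
        simp [show c.v (j₀ + j) - (c.v (j₀ + k) + dir d) = -((c.v (j₀ + k) - c.v (j₀ + j)) + dir d) by abel,
          h0]))
    exact_mod_cast this
  have hbot : ∀ j < n, 0 ≤ (z j - z 0).im := by
    intro j _
    simp only [hz, add_zero]
    rw [embZ2_sub, embZ2_im, Prod.snd_sub]
    have := hlow (j₀ + j)
    push_cast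
    linarith [(Int.cast_le (R := ℝ)).2 this]
  have hhopf := hopf_closed_signed z n hn hzn hzn1 hinj hsub hbot
  -- the total turning is `(π/2) ∑ cross`
  have hE : ∀ v, ((Complex.arg (z (v + 2) - z (v + 1)) : Angle) - (Complex.arg (z (v + 1) - z v) : Angle)).toReal =
      π / 2 * cross (c.v (j₀ + v + 1) - c.v (j₀ + v)) (c.v (j₀ + v + 2) - c.v (j₀ + v + 1)) := by
    intro v
    obtain ⟨i, hi⟩ := exists_step_eq_dir c (j₀ + v)
    obtain ⟨i', hi'⟩ := exists_step_eq_dir c (j₀ + v + 1)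
    have hii' := step_ne_neg_step c hs hn (j₀ + v) hi hi'
    simp only [hz]
    rw [embZ2_sub, embZ2_sub, show j₀ + (v + 2) = j₀ + v + 1 + 1 by omega,
      show j₀ + (v + 1) = j₀ + v + 1 by omega, hi', hi, toReal_argDiff_dir hii']
  have hsum : ∑ v ∈ range n, ((Complex.arg (z (v + 2) - z (v + 1)) : Angle) -
      (Complex.arg (z (v + 1) - z v) : Angle)).toReal =
      π / 2 * ((∑ j ∈ range n, cross (c.v (j + 1) - c.v j) (c.v (j + 2) - c.v (j + 1)) : ℤ) : ℝ) := by
    simp_rw [hE]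
    rw [← mul_sum]
    congr 1
    have hper : ∀ j, cross (c.v (j + n + 1) - c.v (j + n)) (c.v (j + n + 2) - c.v (j + n + 1)) =
        cross (c.v (j + 1) - c.v j) (c.v (j + 2) - c.v (j + 1)) := by
      intro j
      rw [show j + n + 1 = (j + 1) + n by omega, show j + n + 2 = (j + 2) + n by omega,
        c.periodic, c.periodic, c.periodic]
    have := sum_range_shift_of_periodic (g := fun j => (cross (c.v (j + 1) - c.v j) (c.v (j + 2) - c.v (j + 1)) : ℝ))
      (n := n) (fun j => by exact_mod_cast hper j) j₀
    push_cast
    rw [← this]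
  -- the right winding number at the base step equals `R`
  have hR : c.W (ClosedWalk.rf (c.v 0) (c.v 1)) = c.W (ClosedWalk.rf (c.v j₀) (c.v (j₀ + 1))) :=
    (c.W_rf_eq hs hn j₀).symm
  have hz1 : z 1 - z 0 = (((c.v (j₀ + 1) - c.v j₀).1 : ℂ) + ((c.v (j₀ + 1) - c.v j₀).2 : ℂ) * I) := by
    simp only [hz, add_zero]; rw [embZ2_sub]
  have hzp : z (n - 1) - z 0 = (((c.v jp - c.v j₀).1 : ℂ) + ((c.v jp - c.v j₀).2 : ℂ) * I) := by
    simp only [hz, add_zero, hjp]; rw [embZ2_sub]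
  have hπ : π / 2 ≠ 0 := by positivity
  rcases hnext with h1 | h1
  · -- leaving east: counter-clockwise
    left
    have h2 : c.v jp = (X₀, Y₀ + 1) := by
      rcases hprev with h2 | h2
      · exact absurd (h1.trans h2.symm) hne_pn
      · exact h2
    have ha : Complex.arg (z 1 - z 0) = 0 := by
      rw [hz1, h1, hv₀]; simp
    have hb : Complex.arg (z (n - 1) - z 0) = π / 2 := by
      rw [hzp, h2, hv₀]; simp
    have h := hhopf.1 (by rw [ha, hb]; positivity)
    rw [hsum] at h
    refine ⟨?_, ?_⟩
    · have h' : π / 2 * ((∑ j ∈ range n, cross (c.v (j + 1) - c.v j) (c.v (j + 2) - c.v (j + 1)) : ℤ) : ℝ) =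
          π / 2 * 4 := by rw [h]; ring
      exact_mod_cast mul_left_cancel₀ hπ h'
    · have hr : ClosedWalk.rf (X₀, Y₀) (X₀ + 1, Y₀) = (X₀, Y₀ - 1) := by simp [ClosedWalk.rf]
      rw [hR, h1, hv₀, hr]
      exact c.W_eq_zero_of_lt_snd fun j => by have := hlow j; omega
  · -- leaving north: clockwise
    right
    have h2 : c.v jp = (X₀ + 1, Y₀) := by
      rcases hprev with h2 | h2
      · exact h2
      · exact absurd (h1.trans h2.symm) hne_pn
    have ha : Complex.arg (z 1 - z 0) = π / 2 := by
      rw [hz1, h1, hv₀]; simp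
    have hb : Complex.arg (z (n - 1) - z 0) = 0 := by
      rw [hzp, h2, hv₀]; simp
    have h := hhopf.2 (by rw [ha, hb]; positivity)
    rw [hsum] at h
    refine ⟨?_, ?_⟩
    · have h' : π / 2 * ((∑ j ∈ range n, cross (c.v (j + 1) - c.v j) (c.v (j + 2) - c.v (j + 1)) : ℤ) : ℝ) =
          π / 2 * (-4) := by rw [h]; ring
      exact_mod_cast mul_left_cancel₀ hπ h'
    · have hr : ClosedWalk.rf (X₀, Y₀) (X₀, Y₀ + 1) = (X₀, Y₀) := by simp [ClosedWalk.rf, Prod.ext_iff]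
      rw [hR, h1, hv₀, hr]
      -- `W (X₀, Y₀) = W (X₀ - 1, Y₀) - cV X₀ Y₀`, `W (X₀ - 1, Y₀) = W (X₀ - 1, Y₀ - 1) + cH = 0`
      have hwest : ∀ j, c.v j ≠ (X₀ - 1, Y₀) := by
        intro j hj
        rcases hmin' j with h | h <;> rw [hj] at h <;> simp only at h <;> omega
      have e1 : c.W (X₀ - 1, Y₀) = 0 := by
        have := c.W_succ_snd (X₀ - 1) (Y₀ - 1)
        rw [sub_add_cancel, c.cH_eq_zero_of_left hwest, add_zero] at this
        rw [this]
        exact c.W_eq_zero_of_lt_snd fun j => by have := hlow j; omega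
      have hc1 : c.cnt (X₀, Y₀) (X₀, Y₀ + 1) = 1 := by
        rw [← hv₀, c.cnt_out hs hn0, h1]; simp
      have hc2 : c.cnt (X₀, Y₀ + 1) (X₀, Y₀) = 0 := by
        rw [← hv₀, ← hvjp1, c.cnt_in hs hn0, h2, indZ_of_neg]
        simp
      have e2 := c.W_succ_fst (X₀ - 1) Y₀
      rw [sub_add_cancel, e1, c.cV_eq_cnt, hc1, hc2] at e2
      rw [e2]; norm_num

end Walk

end Summit.CriticalPhenomena.CardyFormulaZ2.Cruxes.ParafermionPrecompact.KenyonStreamSecondRelation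

end
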